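import Summits.AtomisticToContinuum.Crystallization.Theorems.ChartedZeroExcessLayeredLatticeLiouvilleZZZYRCXRB

/-!
# ChartedZeroExcessLayeredLatticeLiouville · ZZZYRCXRA — THE θ⁰ OUT-OF-WINDOW KERNEL: ONE OUT-SLAB DECODED (§11: validity and the guarded tables
under a letter sequence)
(decomp-a2c hand-1 g55; target stmt-AtomisticToContinuum-26636 JS-D near reader, line (D) 5c θ_out; critic r1873 (B) «decode/assembly INTO lens-2's
`KernelSlabSoundOut`»; the out analogue of RCXO §4 `slab_valid` / `slab_thetaR0_le` / `slab_thetaN0_le`)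

The out kernel of record runs with `wlo = 600`, `whi = 600 + 2H₀`, `amX = 600 + H₀`; its chords decode by the tree's `decodeChord H₀`.  For a
letter sequence `ℓ` (RCZO `IsLetterSeq`) agreeing with the window word `wordZ win` (`|win| = 2H₀ + 1`), `rhoOf ℓ` is admissible (RCXRB) and
`slabAccO_sound` (RCXRS) applies; §11 reads its three clauses in lens-2's currency: `piece_offsetsL` (no truncation of in-range pieces under
any letters `≤ 2`), ★ `slab_validO` (the guarded piece clause of `KernelSlabSoundOut` (V): centre-based, and `0 < n9F ℓ ≤ P9max` on every piece
whenever the chord is in range under `ℓ`), `coefNpieceF` (+ `_le_rho`), `cast_sum_filter_div'`, ★★ `slab_thetaR0G_le` / `slab_thetaN0G_le`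
(the GUARDED tables `thetaR0G/thetaN0G ℓ lo hi` of the decoded slab at any raw key `k` are at most `tabR/tabN T (codeKO k) / 2^E`).
Imports RCXRB; 0 sorry.  All `[folklore]`.
-/

namespace Summit.AtomisticToContinuum.Crystallization.Theorems.ChartedZeroExcessLayeredLatticeLiouville.ThetaKernel

open scoped BigOperators

/-! ## §11 one out-slab decoded -/

/-- no truncation: a piece with `n9 ≤ P9max ≤ 2·10⁶` under ANY letters `≤ 2` has `|Δγ₀|, |Δγ₁|, |Δm| ≤ 600`. [folklore] -/
theorem piece_offsetsL {ρ : ℕ → ℕ} (hρ2 : ∀ x, ρ x ≤ 2) {P9 : ℕ} (hP9 : P9 ≤ 2000000) (pr : (ℕ × ℕ × ℕ) × (ℕ × ℕ × ℕ))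
    (h9 : n9Z (vecL ρ pr) ≤ P9) :
    pr.1.1 ≤ pr.2.1 + 600 ∧ pr.2.1 ≤ pr.1.1 + 600 ∧ pr.1.2.1 ≤ pr.2.2.1 + 600 ∧ pr.2.2.1 ≤ pr.1.2.1 + 600 ∧
      pr.1.2.2 ≤ pr.2.2.2 + 600 ∧ pr.2.2.2 ≤ pr.1.2.2 + 600 := by
  obtain ⟨⟨a0, a1, am⟩, ⟨b0, b1, bm⟩⟩ := pr
  have hra := hρ2 am
  have hrb := hρ2 bm
  simp only [n9Z, vecL] at h9
  set d : ℤ := (ρ bm : ℤ) - ρ am with hd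
  have hd2 : -2 ≤ d ∧ d ≤ 2 := by constructor <;> omega
  set v0 : ℤ := 3 * ((b0 : ℤ) - a0) + d with hv0
  set v1 : ℤ := 3 * ((b1 : ℤ) - a1) + d with hv1
  set vm : ℤ := (bm : ℤ) - am with hvm
  have hP : (P9 : ℤ) ≤ 2000000 := by exact_mod_cast hP9
  have hq0 := three_sq_le_four_qhex v0 v1
  have hq1 := three_sq_le_four_qhex v1 v0
  have hmm : 0 ≤ vm * vm := mul_self_nonneg vm
  have hqq : 0 ≤ v0 * v0 + v0 * v1 + v1 * v1 := by nlinarith [sq_nonneg (2 * v0 + v1), sq_nonneg v1]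
  have h0 := abs_le_1633 (v := v0) (by nlinarith)
  have h1 := abs_le_1633 (v := v1) (by nlinarith)
  have hm := abs_le_578 (v := vm) (by nlinarith)
  simp only
  omega

/-- the base site of the out kernel of record is the tree's `chordX H₀`; it lies in the letter window. [folklore] -/
theorem chordXO_eq (H₀ : ℕ) : chordXO (600 + H₀) = chordX H₀ := rfl

/-- the base layer `600 + H₀` is in the window `[600, 600 + 2H₀]`. [folklore] -/
theorem inWin_base (H₀ : ℕ) : inWin 600 (600 + 2 * H₀) (600 + H₀) = true := by
  unfold inWin; rw [Bool.and_eq_true, Nat.ble_eq, Nat.ble_eq]; omega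

section OutSlab

variable {win : List ℕ} {H₀ P9 E : ℕ} {lo hi : ℤ} {t0 : PT} {cs : List (List ℕ)} {T : List (ℕ × ℕ × ℕ)} {ℓ : ℤ → ℤ}

/-- ★ ONE OUT-SLAB DECODED — THE GUARDED PIECE CLAUSE (V): every decoded chord is centre-based, and whenever it is in range under `ℓ` every
piece has `0 < n9F ℓ ≤ P9max`. [folklore] -/
theorem slab_validO (hℓ : IsLetterSeq ℓ) (hwl : win.length = 2 * H₀ + 1) (hag : AgreesOnWindow H₀ (wordZ win) ℓ) (hH : H₀ < 601)
    (hne : ∀ c ∈ cs, c ≠ []) (h : slabAccO win 600 (600 + 2 * H₀) (600 + H₀) P9 E lo hi t0 cs = some T) :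
    ∀ c' ∈ cs.map (decodeChord H₀), IsCenterBased H₀ c'.1 ∧
      (lo < n9F ℓ c'.1 → n9F ℓ c'.1 ≤ hi → ∀ i < chordNp c', 0 < n9F ℓ (chordPiece c' i) ∧ n9F ℓ (chordPiece c' i) ≤ (P9 : ℤ)) := by
  intro c' hc'
  obtain ⟨c, hc, rfl⟩ := List.mem_map.mp hc'
  obtain ⟨H1, -, -⟩ := slabAccO_sound (admO_rhoOf hℓ hwl hag) (inWin_base H₀) (by omega) t0 cs T h
  refine ⟨⟨rfl, rfl⟩, fun hlo hhi i hi' => ?_⟩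
  rw [n9F_decodeChord_fst_rho hℓ] at hlo hhi
  rw [chordNp_decodeChord H₀ (hne c hc)] at hi'
  rw [chordPiece_decodeChord H₀ (hne c hc) i, n9F_liftN_rho hℓ]
  obtain ⟨-, -, -, h0, hP⟩ := H1 c hc ⟨hlo, hhi⟩ _ (nodePiece_mem_piecesFrom c (chordX H₀) (dec3 (lastD c 0)) hi')
  exact ⟨h0, hP⟩

/-- the N coefficient of an incidence under `ℓ`, as a function of the PIECE (`coefN0F ℓ c i` is this at `chordPiece c i`, by `rfl`). -/
noncomputable def coefNpieceF (ℓ : ℤ → ℤ) (c : ChordDatum) (y : (Cell 2 × ℤ) × (Cell 2 × ℤ)) : ℝ :=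
  (chordNp c : ℝ) * 45927 * (1 - (d18F ℓ c.1 y : ℝ) ^ 2 / (4 * n9F ℓ c.1 * n9F ℓ y)) / (n9F ℓ c.1 : ℝ) ^ 4

/-- `coefN0F` is `coefNpieceF` at the piece. [folklore] -/
theorem coefN0F_eq_coefNpieceF (ℓ : ℤ → ℤ) (c : ChordDatum) (i : ℕ) : coefN0F ℓ c i = coefNpieceF ℓ c (chordPiece c i) := rfl

/-- the N coefficient at a lifted piece under `ℓ` is dominated by the kernel's dyadic `coefNn / 2^E`. [folklore] -/
theorem coefNpieceF_le_rho (hℓ : IsLetterSeq ℓ) {mX : ℕ} {c : List ℕ} (hc : c ≠ []) (hu : 0 < n9Z (chordEO (rhoOf ℓ) (600 + mX) c))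
    {pr : (ℕ × ℕ × ℕ) × (ℕ × ℕ × ℕ)} (hv : 0 < n9Z (vecL (rhoOf ℓ) pr)) :
    coefNpieceF ℓ (decodeChord mX c) (liftN pr) ≤
      (coefNn (2 ^ E * 45927 * c.length)
          (4 * ((n9Z (chordEO (rhoOf ℓ) (600 + mX) c)).toNat * (n9Z (chordEO (rhoOf ℓ) (600 + mX) c)).toNat *
            ((n9Z (chordEO (rhoOf ℓ) (600 + mX) c)).toNat * (n9Z (chordEO (rhoOf ℓ) (600 + mX) c)).toNat)) *
            (n9Z (chordEO (rhoOf ℓ) (600 + mX) c)).toNat)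
          (4 * (n9Z (chordEO (rhoOf ℓ) (600 + mX) c)).toNat) (n9Z (vecL (rhoOf ℓ) pr)).toNat
          (d18Z (chordEO (rhoOf ℓ) (600 + mX) c) (vecL (rhoOf ℓ) pr)).natAbs : ℝ) / 2 ^ E := by
  unfold coefNpieceF
  rw [chordNp_decodeChord mX hc, n9F_decodeChord_fst_rho hℓ, d18F_decodeChord_fst_rho hℓ, n9F_liftN_rho hℓ]
  exact coefN_real_le E c.length hu hv

/-- the real form of a kernel chord sum with a general key function: `Σ` over the pieces of `ite (key = q) a 0`, cast and divided. [folklore] -/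
theorem cast_sum_filter_div' (L : List ((ℕ × ℕ × ℕ) × (ℕ × ℕ × ℕ))) (key : (ℕ × ℕ × ℕ) × (ℕ × ℕ × ℕ) → ℕ) (q : ℕ)
    (a : (ℕ × ℕ × ℕ) × (ℕ × ℕ × ℕ) → ℕ) (D : ℝ) :
    ((((L.filter fun pr => key pr = q).map a).sum : ℕ) : ℝ) / D = (L.map fun pr => if key pr = q then (a pr : ℝ) / D else 0).sum := by
  rw [sum_map_filter_eq_sum_ite, Nat.cast_list_sum, List.map_map, div_eq_mul_inv, ← List.sum_map_mul_right]
  congr 1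
  refine List.map_congr_left fun pr _ => ?_
  simp only [Function.comp]
  split_ifs <;> simp [div_eq_mul_inv]

/-- ★★ ONE OUT-SLAB DECODED — THE GUARDED R TABLE: `thetaR0G ℓ lo hi` of the decoded slab at ANY raw key `k` is at most the kernel table's
key-wise R sum at `codeKO k`, read at the dyadic exponent `E` (`lo ≥ 0`). [folklore] -/
theorem slab_thetaR0G_le (hℓ : IsLetterSeq ℓ) (hwl : win.length = 2 * H₀ + 1) (hag : AgreesOnWindow H₀ (wordZ win) ℓ) (hH : H₀ < 601)
    (hP9 : P9 ≤ 2000000) (hlo : 0 ≤ lo) (hne : ∀ c ∈ cs, c ≠ [])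
    (h : slabAccO win 600 (600 + 2 * H₀) (600 + H₀) P9 E lo hi t0 cs = some T) (k : ℤ × ℤ × ℤ × ℤ) :
    thetaR0G ℓ lo hi (cs.map (decodeChord H₀)) k ≤ (tabR T (codeKO k) : ℝ) / 2 ^ E := by
  have hρ := admO_rhoOf hℓ hwl hag
  obtain ⟨H1, H2, -⟩ := slabAccO_sound hρ (inWin_base H₀) (by omega) t0 cs T h
  have hpow : (0 : ℝ) < 2 ^ E := by positivity
  set ρ := rhoOf ℓ with hρdef
  -- per chord
  have hchord : ∀ c ∈ cs, (if lo < n9F ℓ (decodeChord H₀ c).1 ∧ n9F ℓ (decodeChord H₀ c).1 ≤ hi then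
      ∑ i ∈ Finset.range (chordNp (decodeChord H₀ c)),
        (if pieceKeyF (chordPiece (decodeChord H₀ c) i) = k then coefR0F ℓ (decodeChord H₀ c) else 0) else 0) ≤
      (chordRO ρ (2 ^ E * 45927) (600 + H₀) lo hi c (codeKO k) : ℝ) / 2 ^ E := by
    intro c hc
    have hcn := hne c hc
    rw [n9F_decodeChord_fst_rho hℓ]
    by_cases hr : inRangeO ρ (600 + H₀) lo hi c
    · have hr' : lo < n9Z (chordEO (rhoOf ℓ) (600 + H₀) c) ∧ n9Z (chordEO (rhoOf ℓ) (600 + H₀) c) ≤ hi := hr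
      rw [if_pos hr']
      unfold chordRO
      rw [if_pos hr]
      have hu : 0 < n9Z (chordEO ρ (600 + H₀) c) := lt_of_le_of_lt hlo hr'.1
      have hpieces := H1 c hc hr
      rw [chordNp_decodeChord H₀ hcn, Finset.sum_congr rfl fun i _ => by rw [chordPiece_decodeChord H₀ hcn i],
        ← sum_map_piecesFrom (fun pr => if pieceKeyF (liftN pr) = k then coefR0F ℓ (decodeChord H₀ c) else 0)
          (dec3 (lastD c 0)) c (chordX H₀), cast_sum_filter_div', ← chordXO_eq]
      refine List.sum_le_sum fun pr hpr => ?_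
      obtain ⟨-, -, -, h0, hP⟩ := hpieces pr hpr
      obtain ⟨o1, -, o2, -, o3, -⟩ := piece_offsetsL hρ.2 hP9 pr hP
      by_cases hk : pieceKeyF (liftN pr) = k
      · have hq : keyOf pr = codeKO k := by rw [keyOf_eq_codeKO pr o1 o2 o3, hk]
        simp only [hk, hq, if_true]
        exact coefR0F_le_rho hℓ hcn hu
      · simp only [hk, if_false]
        split_ifs <;> positivity
    · have hr' : ¬ (lo < n9Z (chordEO (rhoOf ℓ) (600 + H₀) c) ∧ n9Z (chordEO (rhoOf ℓ) (600 + H₀) c) ≤ hi) := hr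
      rw [if_neg hr']
      positivity
  -- sum over chords
  unfold thetaR0G
  rw [List.map_map]
  calc ((cs.map ((fun c => if lo < n9F ℓ c.1 ∧ n9F ℓ c.1 ≤ hi then ∑ i ∈ Finset.range (chordNp c),
          (if pieceKeyF (chordPiece c i) = k then coefR0F ℓ c else 0) else 0) ∘ decodeChord H₀))).sum
      ≤ (cs.map fun c => (chordRO ρ (2 ^ E * 45927) (600 + H₀) lo hi c (codeKO k) : ℝ) / 2 ^ E).sum :=
        List.sum_le_sum fun c hc => hchord c hc
    _ = ((cs.map fun c => chordRO ρ (2 ^ E * 45927) (600 + H₀) lo hi c (codeKO k)).sum : ℕ) / 2 ^ E := by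
        rw [Nat.cast_list_sum, List.map_map, div_eq_mul_inv, ← List.sum_map_mul_right]
        rfl
    _ ≤ (tabR T (codeKO k) : ℝ) / 2 ^ E := by
        gcongr
        exact_mod_cast H2 (codeKO k)

/-- ★★ ONE OUT-SLAB DECODED — THE GUARDED N TABLE: likewise for `thetaN0G` and the key-wise N sums. [folklore] -/
theorem slab_thetaN0G_le (hℓ : IsLetterSeq ℓ) (hwl : win.length = 2 * H₀ + 1) (hag : AgreesOnWindow H₀ (wordZ win) ℓ) (hH : H₀ < 601)
    (hP9 : P9 ≤ 2000000) (hlo : 0 ≤ lo) (hne : ∀ c ∈ cs, c ≠ [])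
    (h : slabAccO win 600 (600 + 2 * H₀) (600 + H₀) P9 E lo hi t0 cs = some T) (k : ℤ × ℤ × ℤ × ℤ) :
    thetaN0G ℓ lo hi (cs.map (decodeChord H₀)) k ≤ (tabN T (codeKO k) : ℝ) / 2 ^ E := by
  have hρ := admO_rhoOf hℓ hwl hag
  obtain ⟨H1, -, H3⟩ := slabAccO_sound hρ (inWin_base H₀) (by omega) t0 cs T h
  have hpow : (0 : ℝ) < 2 ^ E := by positivity
  set ρ := rhoOf ℓ with hρdef
  have hchord : ∀ c ∈ cs, (if lo < n9F ℓ (decodeChord H₀ c).1 ∧ n9F ℓ (decodeChord H₀ c).1 ≤ hi then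
      ∑ i ∈ Finset.range (chordNp (decodeChord H₀ c)),
        (if pieceKeyF (chordPiece (decodeChord H₀ c) i) = k then coefN0F ℓ (decodeChord H₀ c) i else 0) else 0) ≤
      (chordNO ρ (2 ^ E * 45927) (600 + H₀) lo hi c (codeKO k) : ℝ) / 2 ^ E := by
    intro c hc
    have hcn := hne c hc
    rw [n9F_decodeChord_fst_rho hℓ]
    by_cases hr : inRangeO ρ (600 + H₀) lo hi c
    · have hr' : lo < n9Z (chordEO (rhoOf ℓ) (600 + H₀) c) ∧ n9Z (chordEO (rhoOf ℓ) (600 + H₀) c) ≤ hi := hr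
      rw [if_pos hr']
      unfold chordNO
      rw [if_pos hr]
      have hu : 0 < n9Z (chordEO ρ (600 + H₀) c) := lt_of_le_of_lt hlo hr'.1
      have hpieces := H1 c hc hr
      simp only [coefN0F_eq_coefNpieceF]
      rw [chordNp_decodeChord H₀ hcn, Finset.sum_congr rfl fun i _ => by rw [chordPiece_decodeChord H₀ hcn i],
        ← sum_map_piecesFrom (fun pr => if pieceKeyF (liftN pr) = k then coefNpieceF ℓ (decodeChord H₀ c) (liftN pr) else 0)
          (dec3 (lastD c 0)) c (chordX H₀), cast_sum_filter_div', ← chordXO_eq]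
      refine List.sum_le_sum fun pr hpr => ?_
      obtain ⟨-, -, -, h0, hP⟩ := hpieces pr hpr
      obtain ⟨o1, -, o2, -, o3, -⟩ := piece_offsetsL hρ.2 hP9 pr hP
      by_cases hk : pieceKeyF (liftN pr) = k
      · have hq : keyOf pr = codeKO k := by rw [keyOf_eq_codeKO pr o1 o2 o3, hk]
        simp only [hk, hq, if_true]
        exact coefNpieceF_le_rho hℓ hcn hu h0
      · simp only [hk, if_false]
        split_ifs <;> positivity
    · have hr' : ¬ (lo < n9Z (chordEO (rhoOf ℓ) (600 + H₀) c) ∧ n9Z (chordEO (rhoOf ℓ) (600 + H₀) c) ≤ hi) := hr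
      rw [if_neg hr']
      positivity
  unfold thetaN0G
  rw [List.map_map]
  calc ((cs.map ((fun c => if lo < n9F ℓ c.1 ∧ n9F ℓ c.1 ≤ hi then ∑ i ∈ Finset.range (chordNp c),
          (if pieceKeyF (chordPiece c i) = k then coefN0F ℓ c i else 0) else 0) ∘ decodeChord H₀))).sum
      ≤ (cs.map fun c => (chordNO ρ (2 ^ E * 45927) (600 + H₀) lo hi c (codeKO k) : ℝ) / 2 ^ E).sum :=
        List.sum_le_sum fun c hc => hchord c hc
    _ = ((cs.map fun c => chordNO ρ (2 ^ E * 45927) (600 + H₀) lo hi c (codeKO k)).sum : ℕ) / 2 ^ E := by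
        rw [Nat.cast_list_sum, List.map_map, div_eq_mul_inv, ← List.sum_map_mul_right]
        rfl
    _ ≤ (tabN T (codeKO k) : ℝ) / 2 ^ E := by
        gcongr
        exact_mod_cast H3 (codeKO k)

end OutSlab

end Summit.AtomisticToContinuum.Crystallization.Theorems.ChartedZeroExcessLayeredLatticeLiouville.ThetaKernel
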